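import Summits.ResolutionOfSingularities.ResolutionOfSingularities.Theorems.FrobeniusLadderFRationalResolutionMonoidAlgebraLocalization
import Literature.RingTheory.KrullDimension.AffineDimension
import Mathlib.RingTheory.KrullDimension.Polynomial
import Mathlib.RingTheory.KrullDimension.Field
import Mathlib.RingTheory.Localization.Integral
import Mathlib.RingTheory.FiniteType
import Mathlib.GroupTheory.Finiteness
import Mathlib.LinearAlgebra.Dimension.Constructions
import HarnessLib

/-!
# Monoid algebras: `dim k[Q] = rank Qᵍᵖ` for a finitely generated submonoid `Q ⊆ ℤⁿ`

Support file for crux stmt-ResolutionOfSingularities-15317 (`FrobeniusLadder.FRationalResolution`), line `redirect`,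
brick L5 (log regularity of toric algebras; the dimension count in Kato's condition (2.1)(ii)).

* `ringKrullDim_eq_of_isAlgebraic_of_injective` — affine domains `A ⊆ B` over a field with `B` algebraic over
  `A` (e.g. a localization) have the same Krull dimension (`dim = trdeg`, additivity of `trdeg`);
* `exists_add_eq_of_mem_span` — every element of the group `ℤQ` spanned by a submonoid `Q` is a difference of
  two elements of `Q`;
* `ringKrullDim_addMonoidAlgebra_finsupp_int` — `dim k[ℤ^r] = r`;
* `ringKrullDim_addMonoidAlgebra_eq_finrank_span` — **`dim k[Q] = rank_ℤ ℤQ`** for `Q ⊆ ℤⁿ` finitely generated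
  (`k[Q] ⊆ k[ℤQ] ≅ k[ℤ^r]` is a localization).

All folklore (Matsumura Thm. 5.6; CLS 2011 §1.2); no published fact is used.
-/

-- single-problem summit: the doubled namespace component is forced
set_option linter.dupNamespace false

noncomputable section

namespace Summit.ResolutionOfSingularities.ResolutionOfSingularities.Theorems.FRationalResolution

open AddMonoidAlgebra

universe u v

/-- **Algebraic extensions of affine domains preserve the dimension**: for finitely generated `k`-algebras
`A → B` with `B` a domain, the structure map injective and `B` algebraic over `A` (e.g. `B` a localization of
`A`), `dim A = dim B` (both equal the transcendence degree over `k`, which is additive in towers).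
[cite: Matsumura1987, Thm 5.6] -/
theorem ringKrullDim_eq_of_isAlgebraic_of_injective (F : Type u) [Field F] {A B : Type v} [CommRing A]
    [CommRing B] [IsDomain B] [Algebra F A] [Algebra F B] [Algebra A B] [IsScalarTower F A B]
    [Algebra.FiniteType F A] [Algebra.FiniteType F B] (hinj : Function.Injective (algebraMap A B))
    [Algebra.IsAlgebraic A B] : ringKrullDim A = ringKrullDim B := by
  haveI : Nontrivial A := (algebraMap A B).domain_nontrivial
  haveI : NoZeroDivisors A := hinj.noZeroDivisors _ (map_zero _) (map_mul _)
  haveI : IsDomain A := NoZeroDivisors.to_isDomain A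
  haveI : FaithfulSMul F A := (faithfulSMul_iff_algebraMap_injective F A).2 (algebraMap F A).injective
  haveI : FaithfulSMul A B := (faithfulSMul_iff_algebraMap_injective A B).2 hinj
  have h := trdeg_add_eq F A (A := B)
  rw [trdeg_eq_zero (R := A) (A := B), add_zero] at h
  rw [Literature.RingTheory.KrullDimension.ringKrullDim_eq_trdeg F A,
    Literature.RingTheory.KrullDimension.ringKrullDim_eq_trdeg F B, h]

/-- Every element of the subgroup `ℤQ` spanned by a submonoid `Q` of a commutative group is of the form
`a − b` with `a, b ∈ Q` (here: `γ + b = a`). [folklore] -/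
theorem exists_add_eq_of_mem_span {G : Type v} [AddCommGroup G] (Q : AddSubmonoid G) {γ : G}
    (hγ : γ ∈ Submodule.span ℤ (Q : Set G)) : ∃ a ∈ Q, ∃ b ∈ Q, γ + b = a := by
  induction hγ using Submodule.span_induction with
  | mem x hx => exact ⟨x, hx, 0, Q.zero_mem, add_zero x⟩
  | zero => exact ⟨0, Q.zero_mem, 0, Q.zero_mem, add_zero 0⟩
  | add x y _ _ hx hy =>
    obtain ⟨a, ha, b, hb, hab⟩ := hx
    obtain ⟨a', ha', b', hb', hab'⟩ := hy
    exact ⟨a + a', Q.add_mem ha ha', b + b', Q.add_mem hb hb', by rw [← hab, ← hab']; abel⟩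
  | smul z x _ hx =>
    obtain ⟨a, ha, b, hb, hab⟩ := hx
    obtain ⟨m, rfl | rfl⟩ := z.eq_nat_or_neg
    · refine ⟨m • a, Q.nsmul_mem ha m, m • b, Q.nsmul_mem hb m, ?_⟩
      rw [← hab, natCast_zsmul, smul_add]
    · refine ⟨m • b, Q.nsmul_mem hb m, m • a, Q.nsmul_mem ha m, ?_⟩
      rw [← hab, neg_smul, natCast_zsmul, smul_add]
      abel

/-- The additive monoid underlying a finitely generated `ℤ`-module is finitely generated (plumbing).
[folklore] -/
theorem addMonoid_fg_of_module_finite (Γ : Type v) [AddCommGroup Γ] [Module.Finite ℤ Γ] : AddMonoid.FG Γ :=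
  AddGroup.fg_iff_addMonoid_fg.1 ((Module.Finite.iff_addGroup_fg (G := Γ)).1 inferInstance)

variable (k : Type u) [Field k]

/-- **`dim k[ℤ^r] = r`**: the Laurent polynomial ring `k[Fin r →₀ ℤ]` is a localization of `k[X₁, …, X_r]`, an
affine domain of dimension `r`. [folklore] -/
theorem ringKrullDim_addMonoidAlgebra_finsupp_int (r : ℕ) :
    ringKrullDim (AddMonoidAlgebra k (Fin r →₀ ℤ)) = r := by
  let ι : (Fin r →₀ ℕ) →+ (Fin r →₀ ℤ) := Finsupp.mapRange.addMonoidHom (Nat.castAddMonoidHom ℤ)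
  let f : AddMonoidAlgebra k (Fin r →₀ ℕ) →ₐ[k] AddMonoidAlgebra k (Fin r →₀ ℤ) :=
    AddMonoidAlgebra.mapDomainAlgHom k k ι
  letI : Algebra (AddMonoidAlgebra k (Fin r →₀ ℕ)) (AddMonoidAlgebra k (Fin r →₀ ℤ)) := f.toRingHom.toAlgebra
  haveI : IsScalarTower k (AddMonoidAlgebra k (Fin r →₀ ℕ)) (AddMonoidAlgebra k (Fin r →₀ ℤ)) :=
    IsScalarTower.of_algebraMap_eq fun c => (f.commutes c).symm
  have halg : (algebraMap (AddMonoidAlgebra k (Fin r →₀ ℕ)) (AddMonoidAlgebra k (Fin r →₀ ℤ)) :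
      AddMonoidAlgebra k (Fin r →₀ ℕ) →+* AddMonoidAlgebra k (Fin r →₀ ℤ)) = mapDomainRingHom k ι :=
    RingHom.ext fun _ => rfl
  haveI hloc : IsLocalization (MonoidHom.mrange (AddMonoidAlgebra.of k (Fin r →₀ ℕ)))
      (AddMonoidAlgebra k (Fin r →₀ ℤ)) :=
    isLocalization_of_mapDomain k ι (finsuppNatCast_injective r) (finsuppInt_exists_add_eq r) halg
  haveI : Algebra.IsAlgebraic (AddMonoidAlgebra k (Fin r →₀ ℕ)) (AddMonoidAlgebra k (Fin r →₀ ℤ)) :=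
    IsLocalization.isAlgebraic _ (MonoidHom.mrange (AddMonoidAlgebra.of k (Fin r →₀ ℕ)))
  haveI : AddMonoid.FG (Fin r →₀ ℤ) := addMonoid_fg_of_module_finite _
  haveI : Algebra.FiniteType k (AddMonoidAlgebra k (Fin r →₀ ℤ)) := AddMonoidAlgebra.finiteType_of_fg k _
  haveI : Algebra.FiniteType k (AddMonoidAlgebra k (Fin r →₀ ℕ)) :=
    (inferInstance : Algebra.FiniteType k (MvPolynomial (Fin r) k))
  have hinj : Function.Injective (algebraMap (AddMonoidAlgebra k (Fin r →₀ ℕ)) (AddMonoidAlgebra k (Fin r →₀ ℤ))) := by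
    rw [halg]; exact AddMonoidAlgebra.mapDomain_injective (finsuppNatCast_injective r)
  rw [← ringKrullDim_eq_of_isAlgebraic_of_injective k hinj]
  change ringKrullDim (MvPolynomial (Fin r) k) = r
  rw [MvPolynomial.ringKrullDim_of_isNoetherianRing, ringKrullDim_eq_zero_of_field, Nat.card_eq_fintype_card,
    Fintype.card_fin, zero_add]

/-- The submonoid `Q ⊆ ℤⁿ` has unique sums (it embeds in the torsion-free group `ℤⁿ`), so `k[Q]` is a domain
(plumbing). [folklore] -/
theorem uniqueSums_addSubmonoid {G : Type v} [AddCommGroup G] [UniqueSums G] (Q : AddSubmonoid G) :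
    UniqueSums ↥Q :=
  UniqueSums.of_injective_addHom (Q.subtype : ↥Q →ₙ+ G) Subtype.val_injective inferInstance

/-- **`dim k[Q] = rank_ℤ ℤQ`** for a finitely generated submonoid `Q ⊆ ℤⁿ` and a field `k`: `k[Q] ⊆ k[ℤQ]` is the
localization at the monomials (same dimension, both being affine domains) and `k[ℤQ] ≅ k[ℤ^r]`,
`r = rank ℤQ`, has dimension `r`. [cite: Matsumura1987, Thm 5.6] -/
theorem ringKrullDim_addMonoidAlgebra_eq_finrank_span {n : ℕ} (Q : AddSubmonoid (Fin n → ℤ)) (hQ : Q.FG) :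
    ringKrullDim (AddMonoidAlgebra k ↥Q) =
      Module.finrank ℤ ↥(Submodule.span ℤ (Q : Set (Fin n → ℤ))) := by
  set H : Submodule ℤ (Fin n → ℤ) := Submodule.span ℤ (Q : Set (Fin n → ℤ)) with hHdef
  -- the inclusion `Q ↪ ℤQ`
  let ι : ↥Q →+ ↥H :=
    { toFun := fun q => ⟨(q : Fin n → ℤ), Submodule.subset_span q.2⟩
      map_zero' := rfl
      map_add' := fun _ _ => rfl }
  have hι : Function.Injective ι := fun a b hab => by
    have h := congrArg Subtype.val hab
    exact Subtype.ext h
  have hgen : ∀ γ : ↥H, ∃ a b : ↥Q, γ + ι b = ι a := by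
    rintro ⟨γ, hγ⟩
    obtain ⟨a, ha, b, hb, hab⟩ := exists_add_eq_of_mem_span Q hγ
    exact ⟨⟨a, ha⟩, ⟨b, hb⟩, Subtype.ext hab⟩
  let f : AddMonoidAlgebra k ↥Q →ₐ[k] AddMonoidAlgebra k ↥H := AddMonoidAlgebra.mapDomainAlgHom k k ι
  letI : Algebra (AddMonoidAlgebra k ↥Q) (AddMonoidAlgebra k ↥H) := f.toRingHom.toAlgebra
  haveI : IsScalarTower k (AddMonoidAlgebra k ↥Q) (AddMonoidAlgebra k ↥H) :=
    IsScalarTower.of_algebraMap_eq fun c => (f.commutes c).symm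
  have halg : (algebraMap (AddMonoidAlgebra k ↥Q) (AddMonoidAlgebra k ↥H) :
      AddMonoidAlgebra k ↥Q →+* AddMonoidAlgebra k ↥H) = mapDomainRingHom k ι :=
    RingHom.ext fun _ => rfl
  haveI hloc : IsLocalization (MonoidHom.mrange (AddMonoidAlgebra.of k ↥Q)) (AddMonoidAlgebra k ↥H) :=
    isLocalization_of_mapDomain k ι hι hgen halg
  haveI : Algebra.IsAlgebraic (AddMonoidAlgebra k ↥Q) (AddMonoidAlgebra k ↥H) :=
    IsLocalization.isAlgebraic _ (MonoidHom.mrange (AddMonoidAlgebra.of k ↥Q))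
  haveI : UniqueSums ↥H := uniqueSums_addSubmonoid H.toAddSubmonoid
  haveI : IsDomain (AddMonoidAlgebra k ↥H) := inferInstance
  haveI : AddMonoid.FG ↥Q := (AddMonoid.fg_iff_addSubmonoid_fg Q).2 hQ
  haveI : AddMonoid.FG ↥H := addMonoid_fg_of_module_finite ↥H
  haveI : Algebra.FiniteType k (AddMonoidAlgebra k ↥Q) := AddMonoidAlgebra.finiteType_of_fg k _
  haveI : Algebra.FiniteType k (AddMonoidAlgebra k ↥H) := AddMonoidAlgebra.finiteType_of_fg k _
  have hinj : Function.Injective (algebraMap (AddMonoidAlgebra k ↥Q) (AddMonoidAlgebra k ↥H)) := by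
    rw [halg]; exact AddMonoidAlgebra.mapDomain_injective hι
  rw [ringKrullDim_eq_of_isAlgebraic_of_injective k hinj]
  -- `k[ℤQ] ≅ k[ℤ^r]` along a `ℤ`-basis of the free module `ℤQ ⊆ ℤⁿ`
  let e : ↥H ≃+ (Fin (Module.finrank ℤ ↥H) →₀ ℤ) := (Module.finBasis ℤ ↥H).repr.toAddEquiv
  rw [ringKrullDim_eq_of_ringEquiv (AddMonoidAlgebra.domCongr k k e).toRingEquiv,
    ringKrullDim_addMonoidAlgebra_finsupp_int]

end Summit.ResolutionOfSingularities.ResolutionOfSingularities.Theorems.FRationalResolution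

end
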